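import Mathlib
import Summits.Ventures.PercRepro2.K5StarGenB28
import Summits.Ventures.PercRepro2.K5StarBridgeDict
import Summits.Ventures.PercRepro2.TypedStarGenK5

/-!
# THE GENERAL-STAR CERTIFICATES: FROM ONE `CertLE8` PER STAR LIST TO `StarNonnegGen`
(blind cell PercRepro2, mine-2 g41, 2026-08-29; p2's `StarCertsGen` (TypedStarGenCore.lean) certified
statement by statement — `proofs/MINE2-GENSTAR.md`)

A general-star statement `StarNonnegGen R 0 1 2 3 b L` (TypedStarGenK5.lean) is the nonnegativity of the
placement sum `placeSum` of the star list `L` — the nested sum over the placements of the star edges, ending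
in the masked counts `mcount` at the clique masks of the three copies' neighbour sets.  Here:

* **`placeList`** — the placements as a LIST of Finset triples, by the recursion of `placeSum`;
  **`placeSum_eq_msum`**: the placement sum is the sum of the masked counts over `placeList`;
* **`bmask`** — a literal bit mask (`Nat.testBit`, kernel-accelerated), the form the certificates use;
* **`posOn38` / `negOn38`** — the ten positive / ten negative products of `K₃` through the masks as Kronecker
  numbers in base `KB8 = 2^28` (`K5StarGenB28Defs.lean`); `posOn38_eq` / `negOn38_eq`: they encode the masked
  triple counts `cPosOn3b` / `cNegOn3b` of K5StarBridgeDict.lean;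
* **`sumL` / `cSumL`** — the sums over a literal list of mask triples; `sumL_eq` (the encoding adds up),
  `cSumL_le` (the crude digit bound `length · 10 · 3^10`, below `KB8` for `≤ 454` triples);
* **`msum_nonneg_of_cert`** — one certificate `CertLE8 (sumL (negOn38 b) ms) (sumL (posOn38 b) ms)` gives the
  nonnegativity of the masked-count sum at every typed set and type map;
* **`starNonnegGen_of_cert`** — hence `StarNonnegGen R 0 1 2 3 b L` once the placements of `L` are the
  list `ms` (a decided equality of mask lists).

Own code (the digit argument is typer-1's `le_of_certLE` pattern, the dictionary p2's); standard axioms.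
-/

namespace Summit.Ventures.PercRepro2

open Hub

namespace K5

/-! ## Literal masks and the products in base `2^28` -/

section Products

/-- A literal bit mask on the edges of `K₅`: bit `j` of `m`. -/
def bmask (m : ℕ) : Fin 10 → Bool := fun j => m.testBit (j : ℕ)

/-- The positive products of `K₃` on the mask triple `(S₁, S₂, S₃)` at the marking `(0, 1, 2, 3, b)`, in
base `KB8` (`posOn3b` of K5StarCertDefs.lean with `kron38`). -/
def posOn38 (b : ℕ) (S₁ S₂ S₃ : Fin 10 → Bool) : ℕ :=
  kron38 tPD S₁ * kron38 tQ S₂ * kron38 (t4p b) S₃ + kron38 tQ S₁ * kron38 tPDoU S₂ * kron38 (t5p b) S₃ +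
    kron38 tPD S₁ * kron38 tQ S₂ * kron38 (t6m b) S₃ +
    kron38 tPD S₁ * kron38 (t7p b) S₂ * kron38 (t7m 0) S₃ + kron38 tPD S₁ * kron38 (t7m b) S₂ * kron38 (t7p 0) S₃ +
    kron38 tPDoU S₁ * kron38 (t7p b) S₂ * kron38 (t7m 3) S₃ + kron38 tPDoU S₁ * kron38 (t7m b) S₂ * kron38 (t7p 3) S₃ +
    kron38 tPD S₁ * kron38 (t7p b) S₂ * kron38 t10p S₃ + kron38 tPD S₁ * kron38 (t7m b) S₂ * kron38 t10m S₃ +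
    kron38 tQ S₁ * kron38 (t12 b) S₂ * kron38 tPDoU S₃

/-- The negative products of `K₃` on the mask triple `(S₁, S₂, S₃)` at the marking `(0, 1, 2, 3, b)`, in
base `KB8`. -/
def negOn38 (b : ℕ) (S₁ S₂ S₃ : Fin 10 → Bool) : ℕ :=
  kron38 tPD S₁ * kron38 tQ S₂ * kron38 (t4m b) S₃ + kron38 tQ S₁ * kron38 tPDoU S₂ * kron38 (t5m b) S₃ +
    kron38 tPD S₁ * kron38 tQ S₂ * kron38 (t6p b) S₃ +
    kron38 tPD S₁ * kron38 (t7p b) S₂ * kron38 (t7p 0) S₃ + kron38 tPD S₁ * kron38 (t7m b) S₂ * kron38 (t7m 0) S₃ +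
    kron38 tPDoU S₁ * kron38 (t7p b) S₂ * kron38 (t7p 3) S₃ + kron38 tPDoU S₁ * kron38 (t7m b) S₂ * kron38 (t7m 3) S₃ +
    kron38 tPD S₁ * kron38 (t7p b) S₂ * kron38 t10m S₃ + kron38 tPD S₁ * kron38 (t7m b) S₂ * kron38 t10p S₃ +
    kron38 tPD S₁ * kron38 tQ S₂ * kron38 (t11 b) S₃

/-- Ten Kronecker sums in base `KB8` combine. -/
lemma sum_add_mul10_8 (f₁ f₂ f₃ f₄ f₅ f₆ f₇ f₈ f₉ f₁₀ : (Fin 10 → Fin 4) → ℕ) :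
    ∑ k, f₁ k * KB8 ^ idx4 k + ∑ k, f₂ k * KB8 ^ idx4 k + ∑ k, f₃ k * KB8 ^ idx4 k +
      ∑ k, f₄ k * KB8 ^ idx4 k + ∑ k, f₅ k * KB8 ^ idx4 k + ∑ k, f₆ k * KB8 ^ idx4 k +
      ∑ k, f₇ k * KB8 ^ idx4 k + ∑ k, f₈ k * KB8 ^ idx4 k + ∑ k, f₉ k * KB8 ^ idx4 k +
      ∑ k, f₁₀ k * KB8 ^ idx4 k =
      ∑ k, (f₁ k + f₂ k + f₃ k + f₄ k + f₅ k + f₆ k + f₇ k + f₈ k + f₉ k + f₁₀ k) * KB8 ^ idx4 k := by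
  simp only [← Finset.sum_add_distrib]
  exact Finset.sum_congr rfl fun k _ => by ring

/-- `posOn38 b` encodes `cPosOn3b b`. -/
lemma posOn38_eq (b : ℕ) (S₁ S₂ S₃ : Fin 10 → Bool) :
    posOn38 b S₁ S₂ S₃ = ∑ k, cPosOn3b b S₁ S₂ S₃ k * KB8 ^ idx4 k := by
  unfold posOn38
  simp only [kron38_mul_mul]
  rw [sum_add_mul10_8]
  rfl

/-- `negOn38 b` encodes `cNegOn3b b`. -/
lemma negOn38_eq (b : ℕ) (S₁ S₂ S₃ : Fin 10 → Bool) :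
    negOn38 b S₁ S₂ S₃ = ∑ k, cNegOn3b b S₁ S₂ S₃ k * KB8 ^ idx4 k := by
  unfold negOn38
  simp only [kron38_mul_mul]
  rw [sum_add_mul10_8]
  rfl

end Products

/-! ## Sums over a list of mask triples -/

section Lists

/-- A triple of edge masks (one per copy). -/
abbrev Mask3 := (Fin 10 → Bool) × (Fin 10 → Bool) × (Fin 10 → Bool)

/-- The sum of a Kronecker function over a list of mask triples. -/
def sumL (f : (Fin 10 → Bool) → (Fin 10 → Bool) → (Fin 10 → Bool) → ℕ) : List Mask3 → ℕ
  | [] => 0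
  | t :: ms => f t.1 t.2.1 t.2.2 + sumL f ms

/-- The sum of a coefficient function over a list of mask triples, at a profile. -/
def cSumL (c : (Fin 10 → Bool) → (Fin 10 → Bool) → (Fin 10 → Bool) → (Fin 10 → Fin 4) → ℕ) :
    List Mask3 → (Fin 10 → Fin 4) → ℕ
  | [], _ => 0
  | t :: ms, k => c t.1 t.2.1 t.2.2 k + cSumL c ms k

/-- The encodings add up over the list. -/
lemma sumL_eq (f : (Fin 10 → Bool) → (Fin 10 → Bool) → (Fin 10 → Bool) → ℕ)
    (c : (Fin 10 → Bool) → (Fin 10 → Bool) → (Fin 10 → Bool) → (Fin 10 → Fin 4) → ℕ)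
    (hf : ∀ S₁ S₂ S₃, f S₁ S₂ S₃ = ∑ k, c S₁ S₂ S₃ k * KB8 ^ idx4 k) :
    ∀ ms : List Mask3, sumL f ms = ∑ k, cSumL c ms k * KB8 ^ idx4 k
  | [] => by simp [sumL, cSumL]
  | t :: ms => by
    rw [sumL, sumL_eq f c hf ms, hf, sum_add_mulB8]
    rfl

/-- The crude digit bound: `length · 10 · 3^10`. -/
lemma cSumL_le (c : (Fin 10 → Bool) → (Fin 10 → Bool) → (Fin 10 → Bool) → (Fin 10 → Fin 4) → ℕ)
    (hc : ∀ S₁ S₂ S₃ k, c S₁ S₂ S₃ k ≤ 10 * 59049) :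
    ∀ (ms : List Mask3) (k : Fin 10 → Fin 4), cSumL c ms k ≤ ms.length * (10 * 59049)
  | [], k => by simp [cSumL]
  | t :: ms, k => by
    rw [cSumL, List.length_cons, Nat.succ_mul]
    have := hc t.1 t.2.1 t.2.2 k
    have := cSumL_le c hc ms k
    omega

/-- Below `KB8 = 2^28` for at most `454` triples. -/
lemma cSumL_lt (c : (Fin 10 → Bool) → (Fin 10 → Bool) → (Fin 10 → Bool) → (Fin 10 → Fin 4) → ℕ)
    (hc : ∀ S₁ S₂ S₃ k, c S₁ S₂ S₃ k ≤ 10 * 59049) (ms : List Mask3) (hlen : ms.length ≤ 454)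
    (k : Fin 10 → Fin 4) : cSumL c ms k < KB8 := by
  have h := cSumL_le c hc ms k
  have h2 : ms.length * (10 * 59049) ≤ 454 * (10 * 59049) := Nat.mul_le_mul_right _ hlen
  rw [KB8_eq]
  omega

/-- **The digit inequality from one certificate**: for at most `454` mask triples, `CertLE8` on the list
sums gives `cSumL (cNegOn3b b) ms k ≤ cSumL (cPosOn3b b) ms k` at every profile. -/
theorem cSumL_neg_le_pos (b : ℕ) (ms : List Mask3) (hlen : ms.length ≤ 454)
    (hc : CertLE8 (sumL (negOn38 b) ms) (sumL (posOn38 b) ms)) (k : Fin 10 → Fin 4) :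
    cSumL (cNegOn3b b) ms k ≤ cSumL (cPosOn3b b) ms k :=
  le_of_certLE8 (cSumL (cPosOn3b b) ms) (cSumL (cNegOn3b b) ms)
    (cSumL_lt _ (cPosOn3b_le b) ms hlen) (cSumL_lt _ (cNegOn3b_le b) ms hlen)
    (sumL_eq _ _ (posOn38_eq b) ms) (sumL_eq _ _ (negOn38_eq b) ms) hc k

variable {R : Type*} [Field R]

/-- The sum of the masked counts over a list of mask triples. -/
noncomputable def msum (F : Finset (Fin 10)) (z : Config (Fin 10)) (τ : Fin 10 → ℕ)
    (K : Config (Fin 10) → Config (Fin 10) → Config (Fin 10) → R) : List Mask3 → R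
  | [] => 0
  | t :: ms => mcount F z τ t.1 t.2.1 t.2.2 K + msum F z τ K ms

/-- `msum` over an append. -/
lemma msum_append (F : Finset (Fin 10)) (z : Config (Fin 10)) (τ : Fin 10 → ℕ)
    (K : Config (Fin 10) → Config (Fin 10) → Config (Fin 10) → R) :
    ∀ ms ms' : List Mask3, msum F z τ K (ms ++ ms') = msum F z τ K ms + msum F z τ K ms'
  | [], ms' => by simp [msum]
  | t :: ms, ms' => by
    rw [List.cons_append, msum, msum, msum_append F z τ K ms ms', add_assoc]

/-- `msum` over a conditional list. -/
lemma msum_ite (F : Finset (Fin 10)) (z : Config (Fin 10)) (τ : Fin 10 → ℕ)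
    (K : Config (Fin 10) → Config (Fin 10) → Config (Fin 10) → R) (p : Prop) [Decidable p]
    (ms : List Mask3) :
    msum F z τ K (if p then ms else []) = if p then msum F z τ K ms else 0 := by
  split_ifs <;> simp [msum]

/-- The masked-count sum at a profile is the signed coefficient sum. -/
lemma msum_eq (b : Fin 5) (F : Finset (Fin 10)) (z : Config (Fin 10)) (τ : Fin 10 → ℕ)
    (k : Fin 10 → Fin 4) (hk : ∀ e, (k e : ℕ) = if e ∈ F then τ e else if z e then 3 else 0) :
    ∀ ms : List Mask3, msum F z τ (CovForm.K3 (R := R) ends5 0 1 2 3 b) ms =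
      ((cSumL (cPosOn3b b) ms k : ℕ) : R) - ((cSumL (cNegOn3b b) ms k : ℕ) : R)
  | [] => by simp [msum, cSumL]
  | t :: ms => by
    rw [msum, msum_eq b F z τ k hk ms, mcount_eq b F z τ k hk, cSumL, cSumL]
    push_cast
    ring

/-- A masked count vanishes when a typed edge has type above `3`. -/
lemma mcount_eq_zero_of_gt3 (F : Finset (Fin 10)) (z : Config (Fin 10)) (τ : Fin 10 → ℕ)
    (hτ : ¬ ∀ e ∈ F, τ e ≤ 3) (S₁ S₂ S₃ : Fin 10 → Bool)
    (K : Config (Fin 10) → Config (Fin 10) → Config (Fin 10) → R) :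
    mcount F z τ S₁ S₂ S₃ K = 0 := by
  unfold mcount
  exact typedCount_eq_zero_of_gt3 F z τ hτ _

variable [LinearOrder R] [IsStrictOrderedRing R]

/-- **One certificate gives the nonnegativity of the masked-count sum** at every typed set and type map. -/
theorem msum_nonneg_of_cert (n : ℕ) (b : Fin 5) (hb : (b : ℕ) = n) (ms : List Mask3)
    (hlen : ms.length ≤ 454) (hc : CertLE8 (sumL (negOn38 n) ms) (sumL (posOn38 n) ms))
    (F : Finset (Fin 10)) (τ : Fin 10 → ℕ) :
    0 ≤ msum F (fun _ => false) τ (CovForm.K3 (R := R) ends5 0 1 2 3 b) ms := by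
  subst hb
  by_cases hτ : ∀ e ∈ F, τ e ≤ 3
  · obtain ⟨k, hk⟩ := exists_profile F (fun _ => false) τ hτ
    rw [msum_eq b F _ τ k hk ms]
    have h := cSumL_neg_le_pos b ms hlen hc k
    have h' : ((cSumL (cNegOn3b b) ms k : ℕ) : R) ≤ ((cSumL (cPosOn3b b) ms k : ℕ) : R) := by
      exact_mod_cast h
    linarith
  · have : ∀ ms' : List Mask3, msum F (fun _ => false) τ (CovForm.K3 (R := R) ends5 0 1 2 3 b) ms' = 0 := by
      intro ms'
      induction ms' with
      | nil => simp [msum]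
      | cons t ms' ih => rw [msum, ih, mcount_eq_zero_of_gt3 F _ τ hτ, add_zero]
    rw [this]

end Lists

/-! ## The placements of a star list as a list of mask triples -/

section Place

variable {R : Type*} [Field R]

/-- The placements of a star list, by the recursion of `placeSum` (the eight Bool triples in the order
of `Fintype.sum_bool`: `true` first). -/
def placeList : List (Fin 5 × ℕ) → Finset (Fin 5) → Finset (Fin 5) → Finset (Fin 5) →
    List (Finset (Fin 5) × Finset (Fin 5) × Finset (Fin 5))
  | [], s₁, s₂, s₃ => [(s₁, s₂, s₃)]
  | (p, t) :: L, s₁, s₂, s₃ =>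
    (if true.toNat + true.toNat + true.toNat = t then
        placeList L (insert p s₁) (insert p s₂) (insert p s₃) else []) ++
      ((if true.toNat + true.toNat + false.toNat = t then
        placeList L (insert p s₁) (insert p s₂) s₃ else []) ++
      ((if true.toNat + false.toNat + true.toNat = t then
        placeList L (insert p s₁) s₂ (insert p s₃) else []) ++
      ((if true.toNat + false.toNat + false.toNat = t then
        placeList L (insert p s₁) s₂ s₃ else []) ++
      ((if false.toNat + true.toNat + true.toNat = t then
        placeList L s₁ (insert p s₂) (insert p s₃) else []) ++
      ((if false.toNat + true.toNat + false.toNat = t then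
        placeList L s₁ (insert p s₂) s₃ else []) ++
      ((if false.toNat + false.toNat + true.toNat = t then
        placeList L s₁ s₂ (insert p s₃) else []) ++
      (if false.toNat + false.toNat + false.toNat = t then
        placeList L s₁ s₂ s₃ else [])))))))

/-- The clique masks of a Finset triple. -/
def cmask3 (t : Finset (Fin 5) × Finset (Fin 5) × Finset (Fin 5)) : Mask3 :=
  (cliqueMask t.1, cliqueMask t.2.1, cliqueMask t.2.2)

/-- `msum` over a mapped append. -/
lemma msum_map_append (F : Finset (Fin 10)) (z : Config (Fin 10)) (τ : Fin 10 → ℕ)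
    (K : Config (Fin 10) → Config (Fin 10) → Config (Fin 10) → R)
    (l l' : List (Finset (Fin 5) × Finset (Fin 5) × Finset (Fin 5))) :
    msum F z τ K ((l ++ l').map cmask3) = msum F z τ K (l.map cmask3) + msum F z τ K (l'.map cmask3) := by
  rw [List.map_append, msum_append]

/-- `msum` over a mapped conditional list. -/
lemma msum_map_ite (F : Finset (Fin 10)) (z : Config (Fin 10)) (τ : Fin 10 → ℕ)
    (K : Config (Fin 10) → Config (Fin 10) → Config (Fin 10) → R) (p : Prop) [Decidable p]
    (l : List (Finset (Fin 5) × Finset (Fin 5) × Finset (Fin 5))) :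
    msum F z τ K ((if p then l else []).map cmask3) = if p then msum F z τ K (l.map cmask3) else 0 := by
  split_ifs <;> simp [msum]

/-- **The placement sum is the masked-count sum over `placeList`.** -/
theorem placeSum_eq_msum (F : Finset (Fin 10)) (z : Config (Fin 10)) (τ : Fin 10 → ℕ)
    (K : Config (Fin 10) → Config (Fin 10) → Config (Fin 10) → R) :
    ∀ (L : List (Fin 5 × ℕ)) (s₁ s₂ s₃ : Finset (Fin 5)),
      placeSum F z τ K L s₁ s₂ s₃ = msum F z τ K ((placeList L s₁ s₂ s₃).map cmask3)
  | [], s₁, s₂, s₃ => by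
    simp [placeSum, placeList, msum, cmask3]
  | (p, t) :: L, s₁, s₂, s₃ => by
    simp only [placeSum, Fintype.sum_bool, placeList, msum_map_append, msum_map_ite]
    simp only [placeSum_eq_msum F z τ K L]
    simp only [Bool.toNat_true, Bool.toNat_false, Bool.false_eq_true, ite_true,
      ite_false]
    ring_nf

variable [LinearOrder R] [IsStrictOrderedRing R]

/-- **`StarNonnegGen` from one certificate**: once the placements of `L` (through the clique masks) are the
literal mask list `ms`, the certificate `CertLE8` on the list sums gives row 2′TRI on `K₅ + u` with the star
`L`, for every typed set of mark pairs and every type map. -/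
theorem starNonnegGen_of_cert (n : ℕ) (b : Fin 5) (hb : (b : ℕ) = n) (L : List (Fin 5 × ℕ))
    (ms : List Mask3) (hms : (placeList L ∅ ∅ ∅).map cmask3 = ms) (hlen : ms.length ≤ 454)
    (hc : CertLE8 (sumL (negOn38 n) ms) (sumL (posOn38 n) ms)) :
    StarNonnegGen R 0 1 2 3 b L := by
  intro F τ _
  rw [placeSum_eq_msum, hms]
  exact msum_nonneg_of_cert n b hb ms hlen hc F τ

end Place

end K5

end Summit.Ventures.PercRepro2
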